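import Literature.Topology.FourManifolds.SlabSublevelHomology
import HarnessLib

/-!
# Milnor 1965, PDF p. 46: `H⁎(W ∪ W', W; M₀) ≅ H⁎(W', V'; M₀)` — the slab pair and the sublevel pair
# of a Morse function on a cobordism have the same homology, with arbitrary coefficients

Topic `Literature/Topology/FourManifolds`.  The tree's
`Literature.Topology.FourManifolds.Cobordism.IsMorseFunction.isIso_map_slab_sublevel`
(`SlabSublevelHomology.lean`; Milnor, *Lectures on the h-cobordism theorem* (1965), PDF p. 46,
*"`H_{λ+1}(W ∪ W', W) ≅ H_{λ+1}(W', V')`"*, by excision of `{g < A₀ - ε}` and the deformation of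
the collar `g⁻¹[A₀ - ε, A₀]` onto the level `A₀` along a gradient-like flow, Thm. 3.4) is stated
with integer coefficients only, although every ingredient of its proof (excision
`relativeSingularHomology.isIso_map_of_closure_subset_interior_holds`, the deformation lemma
`relativeSingularHomology.isIso_map_of_deformation`, homeomorphisms of pairs) holds for an
arbitrary coefficient module.  This file records the **same theorem for homology with
coefficients in any module `M₀` over any commutative ring `R`**
(`Cobordism.IsMorseFunction.isIso_map_slab_sublevel_coeff`), which the rigidity of natural
de Rham comparisons (`Literature.AlgebraicGeometry.HodgeTheory.NaturalDeRhamComparisonRigidity`,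
homology with complex coefficients) needs.  The proof is that of `SlabSublevelHomology.lean`
verbatim with the coefficients generalised; no definitions, no named facts.

## References

* J. Milnor, *Lectures on the h-cobordism theorem*, notes by L. Siebenmann and J. Sondow,
  Princeton Mathematical Notes (1965), PDF p. 46 (before Lemma 7.2), with Lemma 3.2, Thm. 3.4,
  Lemma 3.5 (PDF pp. 11–13) and the proof of Thm. 4.4 (PDF p. 24). [MilnorHCobordism1965]
* A. Hatcher, *Algebraic Topology* (2002), §2.1, Prop. 2.19, Thm. 2.20. [HatcherAT2002]
-/


open Set Function Filter CategoryTheory Limits unitInterval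
open scoped Manifold Topology ContDiff

noncomputable section

namespace Literature.Topology.FourManifolds

open Literature.AlgebraicTopology.SingularHomology Cobordism FourManifolds.Flow

universe u v

variable (R : Type v) [CommRing R] (M₀ : Type v) [AddCommGroup M₀] [Module R M₀]

variable {n : ℕ} {M N : Type u} [TopologicalSpace M] [ChartedSpace (EuclideanSpace ℝ (Fin n)) M]
  [TopologicalSpace N] [ChartedSpace (EuclideanSpace ℝ (Fin n)) N]

/-- **A map of pairs between pairs with vanishing relative homology (any coefficients) is an
isomorphism on relative homology** (both sides are zero). [folklore] -/
theorem isIso_map_of_isZero_of_isZero_coeff {X Y : Type u} [TopologicalSpace X] [TopologicalSpace Y]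
    {A : Set X} {B : Set Y} (F : C(X, Y)) (hF : MapsTo F A B) (i : ℕ)
    (hX : IsZero (relativeSingularHomology R M₀ X A i))
    (hY : IsZero (relativeSingularHomology R M₀ Y B i)) :
    IsIso (relativeSingularHomology.map R M₀ F hF i) :=
  ⟨⟨0, hX.eq_of_src _ _, hY.eq_of_tgt _ _⟩⟩

/-- **Milnor 1965, PDF p. 46: `H⁎(W ∪ W', W; M₀) ≅ H⁎(W', V'; M₀)`, any coefficients** (the tree's
`Cobordism.IsMorseFunction.isIso_map_slab_sublevel` with the coefficients `ℤ` replaced by an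
arbitrary module `M₀` over a commutative ring `R`): for a Morse function `g` on a cobordism
`c = (W; M, N)` and levels `0 < A₀ < A₁` which are not critical values, the inclusion of pairs
`(g⁻¹[A₀, A₁], g⁻¹(A₀)) → ({g ≤ A₁}, {g ≤ A₀})` induces isomorphisms on relative singular
homology with coefficients in `M₀`.  Proof verbatim that of `SlabSublevelHomology.lean`
(excision of `{g < A₀ - ε}`, and the deformation of the collar `g⁻¹[A₀ - ε, A₀]` onto the level
`A₀` along the trajectories of a gradient-like field).
[cite: MilnorHCobordism1965, PDF p. 46 (before Lemma 7.2), with Lemma 3.2, Thm. 3.4, Lemma 3.5 (PDF pp. 11–13) and the proof of Thm. 4.4 (PDF p. 24)] [cite: HatcherAT2002, §2.1 Prop. 2.19, Thm. 2.20] -/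
theorem Cobordism.IsMorseFunction.isIso_map_slab_sublevel_coeff {c : Cobordism n M N} {g : c.W → ℝ}
    (hg : c.IsMorseFunction g) {A₀ A₁ : ℝ} (hA₀ : 0 < A₀) (hA : A₀ < A₁)
    (hreg : ∀ z ∈ criticalSet (𝓡∂ (n + 1)) g, g z ≠ A₀ ∧ g z ≠ A₁) (i : ℕ) :
    IsIso (relativeSingularHomology.map R M₀
      (⟨fun z => ⟨z.1, z.2.2⟩, by fun_prop⟩ : C(↥(g ⁻¹' Icc A₀ A₁), ↥{z : c.W | g z ≤ A₁}))
      (fun _ hz => le_of_eq hz : MapsTo _ {z : ↥(g ⁻¹' Icc A₀ A₁) | g z.1 = A₀}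
        {z : ↥{z : c.W | g z ≤ A₁} | g z.1 ≤ A₀}) i) := by
  have hgs : ContMDiff (𝓡∂ (n + 1)) 𝓘(ℝ, ℝ) ∞ g := hg.isMorse.contMDiff
  have hgc : Continuous g := hgs.continuous
  ----------------------------------------------------------------------------------------------
  -- The degenerate case `1 ≤ A₀`: both pairs have vanishing homology.
  ----------------------------------------------------------------------------------------------
  by_cases hA₀1 : 1 ≤ A₀
  · refine isIso_map_of_isZero_of_isZero_coeff R M₀ _ _ i ?_ ?_
    · have h : {z : ↥(g ⁻¹' Icc A₀ A₁) | g z.1 = A₀} = univ :=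
        eq_univ_of_forall fun z => le_antisymm (((hg.mem_Icc z.1).2.trans hA₀1)) z.2.1
      rw [h]
      exact isZero_relativeSingularHomology_univ R M₀ i
    · have h : {z : ↥{z : c.W | g z ≤ A₁} | g z.1 ≤ A₀} = univ :=
        eq_univ_of_forall fun z => (hg.mem_Icc z.1).2.trans hA₀1
      rw [h]
      exact isZero_relativeSingularHomology_univ R M₀ i
  rw [not_le] at hA₀1
  ----------------------------------------------------------------------------------------------
  -- Step 1: `ε`, a gradient-like field and the flow of the slab `[A₀ - 2ε, A₀ + ε]`.
  ----------------------------------------------------------------------------------------------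
  have hfin : (criticalSet (𝓡∂ (n + 1)) g).Finite := IsMorse.finite_criticalSet_holds hg.1
  obtain ⟨δ, hδ, hδK⟩ := exists_pos_forall_le_abs_sub hfin.isCompact hgc
    (a := A₀) fun z hz => (hreg z hz).1
  set ε : ℝ := min (δ / 3) (min (A₀ / 3) ((1 - A₀) / 3)) with hεd
  have hε : 0 < ε := by
    rw [hεd]; exact lt_min (by linarith) (lt_min (by linarith) (by linarith))
  have hεδ : 3 * ε ≤ δ := by
    have : ε ≤ δ / 3 := min_le_left _ _; linarith
  have hεA : 3 * ε ≤ A₀ := by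
    have : ε ≤ A₀ / 3 := (min_le_right _ _).trans (min_le_left _ _); linarith
  have hε1 : A₀ + 3 * ε ≤ 1 := by
    have : ε ≤ (1 - A₀) / 3 := (min_le_right _ _).trans (min_le_right _ _); linarith
  set a₀ : ℝ := A₀ - 2 * ε with ha₀d
  set a₁ : ℝ := A₀ + ε with ha₁d
  set u : ℝ := A₀ - ε with hud
  have ha₀pos : 0 < a₀ := by rw [ha₀d]; linarith
  have ha₀a₁ : a₀ < a₁ := by rw [ha₀d, ha₁d]; linarith
  have ha₁1 : a₁ < 1 := by rw [ha₁d]; linarith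
  have hregf : ∀ z, IsMCriticalPt (𝓡∂ (n + 1)) g z → g z ∉ Icc a₀ a₁ := by
    intro z hz hzI
    have h1 := hδK z hz
    rw [ha₀d, ha₁d] at hzI
    have : |g z - A₀| ≤ 2 * ε := abs_le.2 ⟨by linarith [hzI.1], by linarith [hzI.2]⟩
    linarith
  obtain ⟨ξ, hξ⟩ := Cobordism.Milnor1965_exists_isGradientLike_holds (c := c) hg
  obtain ⟨θ, hθ⟩ := hg.exists_slabFlow ξ.contMDiff hξ ha₀pos ha₀a₁ ha₁1
  have hθ' : PreSlabFlow c g ξ a₀ a₁ θ := hθ.toPreSlabFlow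
  -- joint continuity of `(t, x) ↦ π_t(x)` for `t ∈ (a₀, a₁)` and `x` in the slab
  set Ψ : ℝ × c.W → c.W := fun p => levelProj θ g p.1 p.2 with hΨd
  have hΨc : ∀ t ∈ Ioo a₀ a₁, ∀ x, g x ∈ Icc a₀ a₁ → ContinuousAt Ψ (t, x) := by
    intro t ht x hx
    have htr : ∀ a ∈ Ioo a₀ a₁, ∀ y, g y = a →
        0 < mlineDeriv (𝓡∂ (n + 1)) g y (slabField g ξ a₀ a₁ y) :=
      fun a ha => hθ'.transversal hregf (Ioo_subset_Icc_self ha)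
    exact (hθ.isSmoothFlow.contMDiffAt_levelProj_prod hθ.contMDiff_f isOpen_Ioo htr ht
      (hθ'.hits hregf hx (Ioo_subset_Icc_self ht)) (hθ.isInteriorPoint_of_mem_Icc hx)).continuousAt
  have huI : ∀ {t}, t ∈ Icc u A₀ → t ∈ Ioo a₀ a₁ := fun ht => by
    rw [hud] at ht; rw [ha₀d, ha₁d]; exact ⟨by linarith [ht.1], by linarith [ht.2]⟩
  have huI' : ∀ {t}, t ∈ Icc u A₀ → t ∈ Icc a₀ a₁ := fun ht => Ioo_subset_Icc_self (huI ht)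
  ----------------------------------------------------------------------------------------------
  -- Step 3: the slab `Y = g⁻¹[u, A₁]` deformation retracts onto `T = g⁻¹[A₀, A₁]`,
  -- preserving the collar `C = g⁻¹[u, A₀]`.
  ----------------------------------------------------------------------------------------------
  set Y : Set c.W := {z | u ≤ g z ∧ g z ≤ A₁} with hYd
  -- the deformation, on `I × W` first
  set φ : I × c.W → c.W := fun q =>
    if g q.2 ≤ A₀ then Ψ (g q.2 + (q.1 : ℝ) * (A₀ - g q.2), q.2) else q.2 with hφd
  have hlev : ∀ (s : I) (x : c.W), u ≤ g x → g x ≤ A₀ →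
      g x + (s : ℝ) * (A₀ - g x) ∈ Icc u A₀ := by
    intro s x hux hxA
    have hs0 : (0 : ℝ) ≤ s := s.2.1
    have hs1 : (s : ℝ) ≤ 1 := s.2.2
    constructor
    · nlinarith
    · nlinarith
  have hφc : ContinuousOn φ (univ ×ˢ Y) := by
    refine ContinuousOn.if ?_ ?_ ?_
    · -- on the frontier `g x = A₀` both branches agree
      rintro ⟨s, x⟩ ⟨hq, hfr⟩
      have hfr' : g x = A₀ := by
        have := frontier_le_subset_eq (hgc.comp continuous_snd) continuous_const hfr
        exact this
      show Ψ (g x + (s : ℝ) * (A₀ - g x), x) = x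
      rw [hfr', sub_self, mul_zero, add_zero]
      exact hθ'.levelProj_of_apply_eq hregf (huI' ⟨by rw [hud]; linarith, le_rfl⟩) hfr'
    · -- on the collar: joint continuity of the projection
      rintro ⟨s, x⟩ ⟨⟨-, hxY⟩, hxle⟩
      have hxle' : g x ≤ A₀ := by
        have hcl : IsClosed {a : I × c.W | g a.2 ≤ A₀} :=
          isClosed_le (by fun_prop) continuous_const
        rw [hcl.closure_eq] at hxle
        exact hxle
      have hxI : g x ∈ Icc u A₀ := ⟨hxY.1, hxle'⟩
      have ht := hlev s x hxY.1 hxle'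
      have h1 : ContinuousAt (fun q : I × c.W => (g q.2 + (q.1 : ℝ) * (A₀ - g q.2), q.2))
          (s, x) := by
        fun_prop
      exact (ContinuousAt.comp
        (f := fun q : I × c.W => (g q.2 + (q.1 : ℝ) * (A₀ - g q.2), q.2)) (x := (s, x))
        (hΨc _ (huI ht) x (huI' hxI)) h1).continuousWithinAt
    · exact continuous_snd.continuousOn
  have hφY : ∀ (s : I) (y : c.W), y ∈ Y → φ (s, y) ∈ Y := by
    intro s y hy
    by_cases hyA : g y ≤ A₀
    · have ht := hlev s y hy.1 hyA
      have hval : g (Ψ (g y + (s : ℝ) * (A₀ - g y), y)) = g y + (s : ℝ) * (A₀ - g y) :=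
        hθ'.apply_levelProj hregf (huI' ⟨hy.1, hyA⟩) (huI' ht)
      simp only [hφd, hyA, if_true]
      exact ⟨by rw [hval]; exact ht.1, by rw [hval]; exact ht.2.trans hA.le⟩
    · simp only [hφd, hyA, if_false]
      exact hy
  set H : C(I × ↥Y, ↥Y) :=
    ⟨fun q => ⟨φ (q.1, q.2.1), hφY q.1 q.2.1 q.2.2⟩,
      (hφc.comp_continuous (continuous_fst.prodMk (continuous_subtype_val.comp continuous_snd))
        fun q => ⟨mem_univ _, q.2.2⟩).subtype_mk _⟩ with hHd
  set T : Set ↥Y := {y | A₀ ≤ g y.1} with hTd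
  set C : Set ↥Y := {y | g y.1 ≤ A₀} with hCd
  have hH0 : ∀ y : ↥Y, H (0, y) = y := by
    intro y
    apply Subtype.ext
    show φ (0, y.1) = y.1
    by_cases hyA : g y.1 ≤ A₀
    · simp only [hφd, hyA, if_true, Icc.coe_zero, zero_mul, add_zero]
      exact hθ'.levelProj_of_apply_eq hregf (huI' ⟨y.2.1, hyA⟩) rfl
    · simp only [hφd, hyA, if_false]
  have hH1 : ∀ y : ↥Y, H (1, y) ∈ T := by
    intro y
    show A₀ ≤ g (φ (1, y.1))
    by_cases hyA : g y.1 ≤ A₀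
    · simp only [hφd, hyA, if_true, Icc.coe_one, one_mul, add_sub_cancel]
      exact (hθ'.apply_levelProj hregf (huI' ⟨y.2.1, hyA⟩)
        (huI' ⟨by rw [hud]; linarith, le_rfl⟩)).ge
    · simp only [hφd, hyA, if_false]
      exact (not_le.1 hyA).le
  have hHfix : ∀ (s : I), ∀ y ∈ T, H (s, y) = y := by
    intro s y hy
    apply Subtype.ext
    show φ (s, y.1) = y.1
    by_cases hyA : g y.1 ≤ A₀
    · have heq : g y.1 = A₀ := le_antisymm hyA hy
      simp only [hφd, hyA, if_true]
      rw [heq, sub_self, mul_zero, add_zero]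
      exact hθ'.levelProj_of_apply_eq hregf (huI' ⟨by rw [hud]; linarith, le_rfl⟩) heq
    · simp only [hφd, hyA, if_false]
  have hHC : ∀ (s : I), ∀ y ∈ C, H (s, y) ∈ C := by
    intro s y hy
    show g (φ (s, y.1)) ≤ A₀
    have hyA : g y.1 ≤ A₀ := hy
    simp only [hφd, hyA, if_true]
    rw [hθ'.apply_levelProj hregf (huI' ⟨y.2.1, hyA⟩) (huI' (hlev s y.1 y.2.1 hyA))]
    exact (hlev s y.1 y.2.1 hyA).2
  have hdef : IsIso (relativeSingularHomology.map R M₀ (subsetIncl T)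
      (relativeSingularHomology.mapsTo_subsetIncl_preimage T C) i) :=
    relativeSingularHomology.isIso_map_of_deformation R M₀ T H hH0 hH1 hHfix hHC i
  ----------------------------------------------------------------------------------------------
  -- Step 2: excision of `U = {g < u}` from `({g ≤ A₁}, {g ≤ A₀})`.
  ----------------------------------------------------------------------------------------------
  set B : Set c.W := {z | g z ≤ A₁} with hBd
  set A : Set ↥B := {z | g z.1 ≤ A₀} with hAd
  set U : Set ↥B := {z | g z.1 < u} with hUd
  have hgB : Continuous fun z : ↥B => g z.1 := hgc.comp continuous_subtype_val
  have hUA : closure U ⊆ interior A := by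
    have h1 : closure U ⊆ {z : ↥B | g z.1 ≤ u} :=
      closure_minimal (show U ⊆ {z : ↥B | g z.1 ≤ u} from fun z hz => le_of_lt (α := ℝ) hz)
        (isClosed_le hgB continuous_const)
    have h2 : {z : ↥B | g z.1 < A₀} ⊆ interior A :=
      interior_maximal (show {z : ↥B | g z.1 < A₀} ⊆ A from fun z hz => le_of_lt (α := ℝ) hz)
        (isOpen_lt hgB continuous_const)
    exact h1.trans fun z hz => h2 (show g z.1 < A₀ by
      have : g z.1 ≤ u := hz
      rw [hud] at this; linarith)
  have hexc : IsIso (relativeSingularHomology.map R M₀ (X := ↥Uᶜ) (subsetIncl Uᶜ)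
      (Set.mapsTo_preimage Subtype.val A : Set.MapsTo _ (Subtype.val ⁻¹' A) A) i) :=
    relativeSingularHomology.isIso_map_of_closure_subset_interior_holds R M₀ (↥B) hUA i
  ----------------------------------------------------------------------------------------------
  -- Step 4: the two tautological homeomorphisms of pairs, and the composite.
  ----------------------------------------------------------------------------------------------
  -- `g⁻¹[A₀, A₁] ≃ T` (with `g⁻¹(A₀) ↔ T ∩ C`)
  have huA₀ : u ≤ A₀ := by rw [hud]; linarith
  set e₁ : ↥(g ⁻¹' Icc A₀ A₁) ≃ₜ ↥T :=
    { toFun := fun z => ⟨⟨z.1, huA₀.trans z.2.1, z.2.2⟩, z.2.1⟩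
      invFun := fun y => ⟨y.1.1, y.2, y.1.2.2⟩
      left_inv := fun _ => rfl
      right_inv := fun _ => rfl
      continuous_toFun := by fun_prop
      continuous_invFun := by fun_prop } with he₁d
  have he₁ : MapsTo e₁ {z : ↥(g ⁻¹' Icc A₀ A₁) | g z.1 = A₀} (Subtype.val ⁻¹' C) :=
    fun z hz => le_of_eq hz
  have he₁' : MapsTo e₁.symm (Subtype.val ⁻¹' C) {z : ↥(g ⁻¹' Icc A₀ A₁) | g z.1 = A₀} :=
    fun y hy => le_antisymm hy y.2
  -- `Y ≃ Uᶜ` (with `C ↔ Uᶜ ∩ A`)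
  set e₂ : ↥Y ≃ₜ ↥(Uᶜ : Set ↥B) :=
    { toFun := fun y => ⟨⟨y.1, y.2.2⟩, not_lt.2 y.2.1⟩
      invFun := fun w => ⟨w.1.1, not_lt.1 w.2, w.1.2⟩
      left_inv := fun _ => rfl
      right_inv := fun _ => rfl
      continuous_toFun := by fun_prop
      continuous_invFun := by fun_prop } with he₂d
  have he₂ : MapsTo e₂ C (Subtype.val ⁻¹' A) := fun y hy => hy
  have he₂' : MapsTo e₂.symm (Subtype.val ⁻¹' A) C := fun w hw => hw
  haveI hiso₁ := relativeSingularHomology.isIso_map_homeomorph R M₀ e₁ he₁ he₁' i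
  haveI hiso₂ := relativeSingularHomology.isIso_map_homeomorph R M₀ e₂ he₂ he₂' i
  haveI := hdef
  haveI := hexc
  have hcomp : relativeSingularHomology.map R M₀
      (⟨fun z => ⟨z.1, z.2.2⟩, by fun_prop⟩ : C(↥(g ⁻¹' Icc A₀ A₁), ↥{z : c.W | g z ≤ A₁}))
      (fun _ hz => le_of_eq hz : MapsTo _ {z : ↥(g ⁻¹' Icc A₀ A₁) | g z.1 = A₀}
        {z : ↥{z : c.W | g z ≤ A₁} | g z.1 ≤ A₀}) i =
      relativeSingularHomology.map R M₀ (e₁ : C(_, _)) he₁ i ≫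
        relativeSingularHomology.map R M₀ (subsetIncl T)
          (relativeSingularHomology.mapsTo_subsetIncl_preimage T C) i ≫
        relativeSingularHomology.map R M₀ (e₂ : C(_, _)) he₂ i ≫
        relativeSingularHomology.map R M₀ (X := ↥Uᶜ) (subsetIncl Uᶜ)
          (Set.mapsTo_preimage Subtype.val A : Set.MapsTo _ (Subtype.val ⁻¹' A) A) i := by
    rw [← relativeSingularHomology.map_comp, ← relativeSingularHomology.map_comp,
      ← relativeSingularHomology.map_comp]
    exact relativeSingularHomology.map_congr R M₀ (by ext z; rfl) _ _ i
  rw [hcomp]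
  infer_instance

end Literature.Topology.FourManifolds
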